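import Literature.AlgebraicTopology.KTheory.WedgeCollapse
import Literature.AlgebraicTopology.KTheory.SphereCaps
import Mathlib.Topology.Compactification.OnePoint.Sphere
import HarnessLib

/-!
# The smash product of spheres: `(S^p × S^q)/(S^p ∨ S^q) ≅ S^{p+q}`, and `K̃` along homeomorphisms

For the passage from Bott periodicity over `X × S²` to spheres (Hatcher, *Vector Bundles and
K-Theory*, §2.1, proof of Cor. 2.12 `K̃(Sⁿ⁺²) ≅ K̃(Sⁿ)` via `Sⁿ ∧ S² = Sⁿ⁺²`; Husemöller,
*Fibre Bundles*, Ch. 11 §1) one needs the identification of the collapse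
`(S^p × S^q)/(S^p ∨ S^q)` (`Collapse`, `prodWedgeC` of this directory) with the sphere `S^{p+q}`.
We obtain it from one-point compactifications:

* §1 `smashHomeomorph` — if `σ : X → S`, `τ : Y → T` are open embeddings into compact Hausdorff
  spaces with one-point complements `{s₀}`, `{t₀}`, then `(x, y) ↦ [σ x, τ y]` is an open embedding
  `X × Y → (S × T)/(S ∨ T)` with complement the base point, so that
  `OnePoint (X × Y) ≃ₜ (S × T)/(S ∨ T)` (`OnePoint.equivOfIsEmbeddingOfRangeEq`), `∞ ↦ pt`;
* §2 spheres: the pole `pole n = e_last ∈ Sⁿ ⊆ ℝⁿ⁺¹`, the homeomorphism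
  `onePointHomeoSphere : OnePoint V ≃ₜ Sⁿ` (`dim V = n`, `∞ ↦ pole n`; Mathlib's stereographic
  `onePointHyperplaneHomeoUnitSphere`), the open embedding `sphereStereo n : ℝⁿ → Sⁿ` onto
  `{pole n}ᶜ`, and **`sphereSmashHomeomorph p q : (S^p × S^q)/(S^p ∨ S^q) ≃ₜ S^{p+q}`** with
  `pt ↦ pole (p + q)`;
* §3 `K̃` is invariant under homeomorphisms (`reduced_eq_bot_of_homeomorph`), hence
  `reduced_sphere_eq_bot_of_smash : K̃((S^p × S^q)/(S^p ∨ S^q)) = 0 → K̃(S^{p+q}) = 0`, and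
  `reduced_sphere_one_eq_bot : K̃(S¹) = 0` at every base point (from `SphereCaps.lean`).

Everything is proved; no named facts.

## References

* A. Hatcher, *Vector Bundles and K-Theory* (v2.2, 2017), §2.1 p. 55 and Cor. 2.12
  (`Sⁿ ∧ S² = Sⁿ⁺²`). [HatcherVBKT2017]
* D. Husemöller, *Fibre Bundles*, 3rd ed., GTM 20 (1994), Ch. 11 §1, Cor. 1.4. [HusemollerFibreBundles1994]

## Design notes

* Mathlib: `onePointEquivSphereOfFinrankEq` fixes the image of `∞` only up to
  `Classical.arbitrary`; we re-assemble it from `onePointHyperplaneHomeoUnitSphere` with the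
  explicit pole `e_last`, so that base points are tracked through the induction on spheres.
-/

noncomputable section

namespace Literature.AlgebraicTopology.KTheory

open Literature.RingTheory.KTheory Set Metric Module TopologicalSpace _root_.Topology

universe u v

/-! ### 1. `OnePoint (X × Y) ≅ (S × T)/(S ∨ T)` for one-point compactifications `S ⊇ X`, `T ⊇ Y` -/

section Smash

variable {X : Type*} {Y : Type*} {S : Type u} {T : Type v} {σ : X → S} {τ : Y → T} {s₀ : S} {t₀ : T}

/-- Points of the form `(σ x, τ y)` are off the wedge when `σ`, `τ` miss the base points. [folklore] -/
theorem prodMap_not_mem_prodWedge (hs : range σ = {s₀}ᶜ) (ht : range τ = {t₀}ᶜ) (p : X × Y) :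
    (σ p.1, τ p.2) ∉ prodWedge s₀ t₀ := by
  have h1 : σ p.1 ∈ ({s₀}ᶜ : Set S) := hs ▸ mem_range_self p.1
  have h2 : τ p.2 ∈ ({t₀}ᶜ : Set T) := ht ▸ mem_range_self p.2
  rintro (h | h)
  · exact h1 h
  · exact h2 h

variable [TopologicalSpace X] [TopologicalSpace Y] [TopologicalSpace S] [TopologicalSpace T] [T1Space S] [T1Space T]

/-- **`(x, y) ↦ [σ x, τ y]` is an open embedding `X × Y → (S × T)/(S ∨ T)`** when `σ`, `τ` are open
embeddings onto the complements of the base points. [cite: HatcherVBKT2017, §2.1 p. 55] -/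
theorem isOpenEmbedding_mk_prodMap (hσ : IsOpenEmbedding σ) (hτ : IsOpenEmbedding τ)
    (hs : range σ = {s₀}ᶜ) (ht : range τ = {t₀}ᶜ) :
    IsOpenEmbedding fun p : X × Y ↦ Collapse.mk (prodWedgeC s₀ t₀) (σ p.1, τ p.2) := by
  have hστ : IsOpenEmbedding (Prod.map σ τ) := hσ.prodMap hτ
  refine IsOpenEmbedding.of_continuous_injective_isOpenMap
    ((Collapse.mk (prodWedgeC s₀ t₀)).continuous.comp hστ.continuous) ?_ ?_
  · intro p p' h
    have h' := (Collapse.mk_eq_mk_iff (A := prodWedgeC s₀ t₀)).1 h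
    rcases h' with h' | ⟨h', -⟩
    · exact hστ.injective h'
    · exact absurd h' (prodMap_not_mem_prodWedge hs ht p)
  · intro U hU
    rw [show (fun p : X × Y ↦ Collapse.mk (prodWedgeC s₀ t₀) (σ p.1, τ p.2)) '' U =
        Collapse.mk (prodWedgeC s₀ t₀) '' (Prod.map σ τ '' U) from (image_image _ _ _).symm]
    refine Collapse.isOpen_image_mk (hστ.isOpenMap U hU) ?_
    rw [Set.disjoint_left]
    rintro _ ⟨p, -, rfl⟩
    exact prodMap_not_mem_prodWedge hs ht p

omit [TopologicalSpace X] [TopologicalSpace Y] in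
/-- The range of `(x, y) ↦ [σ x, τ y]` is the complement of the base point. [cite: HatcherVBKT2017, §2.1 p. 55] -/
theorem range_mk_prodMap (hs : range σ = {s₀}ᶜ) (ht : range τ = {t₀}ᶜ) :
    range (fun p : X × Y ↦ Collapse.mk (prodWedgeC s₀ t₀) (σ p.1, τ p.2)) = {Collapse.pt (prodWedgeC s₀ t₀)}ᶜ := by
  ext z
  constructor
  · rintro ⟨p, rfl⟩ h
    exact prodMap_not_mem_prodWedge hs ht p ((Collapse.mk_eq_pt_iff (A := prodWedgeC s₀ t₀)).1 h)
  · intro hz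
    rcases Collapse.eq_pt_or_eq_mk z with rfl | ⟨⟨s, t⟩, hw, rfl⟩
    · exact absurd rfl hz
    · have hs' : s ∈ range σ := by
        rw [hs]; exact fun h ↦ hw (Or.inl h)
      have ht' : t ∈ range τ := by
        rw [ht]; exact fun h ↦ hw (Or.inr h)
      obtain ⟨x, rfl⟩ := hs'
      obtain ⟨y, rfl⟩ := ht'
      exact ⟨(x, y), rfl⟩

variable [CompactSpace S] [CompactSpace T] [T2Space S] [T2Space T]

/-- **The smash product as a one-point compactification**: `OnePoint (X × Y) ≃ₜ (S × T)/(S ∨ T)`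
for open embeddings `σ : X → S`, `τ : Y → T` with one-point complements (e.g.
`ℝᵖ × ℝ^q ⊆ S^p × S^q`, giving `S^p ∧ S^q = S^{p+q}`). [cite: HatcherVBKT2017, §2.1 p. 55] -/
def smashHomeomorph (hσ : IsOpenEmbedding σ) (hτ : IsOpenEmbedding τ) (hs : range σ = {s₀}ᶜ) (ht : range τ = {t₀}ᶜ) :
    OnePoint (X × Y) ≃ₜ Collapse (S × T) (prodWedgeC s₀ t₀) :=
  OnePoint.equivOfIsEmbeddingOfRangeEq (Collapse.pt (prodWedgeC s₀ t₀)) _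
    (isOpenEmbedding_mk_prodMap hσ hτ hs ht).toIsEmbedding (range_mk_prodMap hs ht)

/-- `smashHomeomorph` sends `∞` to the base point. [folklore] -/
@[simp] theorem smashHomeomorph_infty (hσ : IsOpenEmbedding σ) (hτ : IsOpenEmbedding τ) (hs : range σ = {s₀}ᶜ)
    (ht : range τ = {t₀}ᶜ) : smashHomeomorph hσ hτ hs ht OnePoint.infty = Collapse.pt (prodWedgeC s₀ t₀) := rfl

/-- `smashHomeomorph` on finite points. [folklore] -/
@[simp] theorem smashHomeomorph_coe (hσ : IsOpenEmbedding σ) (hτ : IsOpenEmbedding τ) (hs : range σ = {s₀}ᶜ)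
    (ht : range τ = {t₀}ᶜ) (p : X × Y) :
    smashHomeomorph hσ hτ hs ht (p : OnePoint (X × Y)) = Collapse.mk (prodWedgeC s₀ t₀) (σ p.1, τ p.2) := rfl

end Smash

/-! ### 2. Spheres -/

section Spheres

/-- The **pole** `e_last ∈ Sⁿ ⊆ ℝⁿ⁺¹` (base point of the `n`-sphere in this file). [folklore] -/
def pole (n : ℕ) : sphere (0 : EuclideanSpace ℝ (Fin (n + 1))) 1 :=
  ⟨EuclideanSpace.single (Fin.last n) 1, by simp⟩

/-- The pole as a vector. [folklore] -/
@[simp] theorem coe_pole (n : ℕ) : (pole n : EuclideanSpace ℝ (Fin (n + 1))) = EuclideanSpace.single (Fin.last n) 1 := rfl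

/-- The pole has norm one. [folklore] -/
theorem norm_pole (n : ℕ) : ‖(pole n : EuclideanSpace ℝ (Fin (n + 1)))‖ = 1 := by simp

/-- The pole is nonzero. [folklore] -/
theorem pole_ne_zero (n : ℕ) : (pole n : EuclideanSpace ℝ (Fin (n + 1))) ≠ 0 := fun h ↦ by
  have := norm_pole n
  rw [h, norm_zero] at this
  exact zero_ne_one this

/-- **`OnePoint V ≃ₜ Sⁿ` with `∞ ↦ pole n`**, for an `n`-dimensional real normed space `V`
(stereographic projection from the pole; Mathlib's `onePointHyperplaneHomeoUnitSphere` composed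
with a linear homeomorphism `V ≅ (ℝ e_last)ᗮ`). [folklore] -/
def onePointHomeoSphere (V : Type*) [NormedAddCommGroup V] [NormedSpace ℝ V] [FiniteDimensional ℝ V]
    (n : ℕ) (h : finrank ℝ V = n) : OnePoint V ≃ₜ sphere (0 : EuclideanSpace ℝ (Fin (n + 1))) 1 :=
  haveI : Fact (finrank ℝ (EuclideanSpace ℝ (Fin (n + 1))) = n + 1) := ⟨by simp⟩
  have hV : finrank ℝ V = finrank ℝ (Submodule.span ℝ {(pole n : EuclideanSpace ℝ (Fin (n + 1)))})ᗮ := by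
    rw [Submodule.finrank_orthogonal_span_singleton (n := n) (pole_ne_zero n), h]
  (ContinuousLinearEquiv.ofFinrankEq hV).toHomeomorph.onePointCongr.trans
    (onePointHyperplaneHomeoUnitSphere (norm_pole n))

/-- `onePointHomeoSphere` sends `∞` to the pole. [folklore] -/
@[simp] theorem onePointHomeoSphere_infty (V : Type*) [NormedAddCommGroup V] [NormedSpace ℝ V]
    [FiniteDimensional ℝ V] (n : ℕ) (h : finrank ℝ V = n) :
    onePointHomeoSphere V n h OnePoint.infty = pole n := rfl

/-- **Stereographic parametrisation** `ℝⁿ → Sⁿ` of the complement of the pole. [folklore] -/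
def sphereStereo (n : ℕ) : EuclideanSpace ℝ (Fin n) → sphere (0 : EuclideanSpace ℝ (Fin (n + 1))) 1 :=
  fun x ↦ onePointHomeoSphere (EuclideanSpace ℝ (Fin n)) n (by simp) (x : OnePoint (EuclideanSpace ℝ (Fin n)))

/-- `sphereStereo n` is an open embedding. [folklore] -/
theorem isOpenEmbedding_sphereStereo (n : ℕ) : IsOpenEmbedding (sphereStereo n) :=
  (Homeomorph.isOpenEmbedding _).comp OnePoint.isOpenEmbedding_coe

/-- The range of `sphereStereo n` is the complement of the pole. [folklore] -/
theorem range_sphereStereo (n : ℕ) : range (sphereStereo n) = {pole n}ᶜ := by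
  set e := onePointHomeoSphere (EuclideanSpace ℝ (Fin n)) n (by simp)
  change range (e ∘ ((↑) : EuclideanSpace ℝ (Fin n) → OnePoint (EuclideanSpace ℝ (Fin n)))) = _
  rw [range_comp, ← OnePoint.compl_infty, Set.image_compl_eq e.bijective, image_singleton]
  rfl

/-- **`(S^p × S^q)/(S^p ∨ S^q) ≃ₜ S^{p+q}`** (the smash product of spheres is a sphere), with the
wedge taken at the poles; the base point goes to the pole (`sphereSmashHomeomorph_pt`).
[cite: HatcherVBKT2017, §2.1 Cor. 2.12] -/
def sphereSmashHomeomorph (p q : ℕ) :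
    Collapse (sphere (0 : EuclideanSpace ℝ (Fin (p + 1))) 1 × sphere (0 : EuclideanSpace ℝ (Fin (q + 1))) 1)
        (prodWedgeC (pole p) (pole q)) ≃ₜ sphere (0 : EuclideanSpace ℝ (Fin (p + q + 1))) 1 :=
  (smashHomeomorph (isOpenEmbedding_sphereStereo p) (isOpenEmbedding_sphereStereo q) (range_sphereStereo p)
      (range_sphereStereo q)).symm.trans
    (onePointHomeoSphere (EuclideanSpace ℝ (Fin p) × EuclideanSpace ℝ (Fin q)) (p + q) (by simp))

/-- `sphereSmashHomeomorph` sends the base point to the pole. [folklore] -/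
@[simp] theorem sphereSmashHomeomorph_pt (p q : ℕ) :
    sphereSmashHomeomorph p q (Collapse.pt (prodWedgeC (pole p) (pole q))) = pole (p + q) := by
  have h1 : (smashHomeomorph (isOpenEmbedding_sphereStereo p) (isOpenEmbedding_sphereStereo q) (range_sphereStereo p)
      (range_sphereStereo q)).symm (Collapse.pt (prodWedgeC (pole p) (pole q))) = OnePoint.infty := by
    rw [Homeomorph.symm_apply_eq]; rfl
  rw [sphereSmashHomeomorph, Homeomorph.trans_apply, h1]
  rfl

end Spheres

/-! ### 3. `K̃` along homeomorphisms; consequences for spheres -/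

section KTheory

variable {Z : Type u} {W : Type v} [TopologicalSpace Z] [TopologicalSpace W]

/-- Pull-back along a homeomorphism and its inverse compose to the identity. [folklore] -/
theorem pullback_homeomorph_symm_apply (h : Z ≃ₜ W) (a : K0 Z) :
    pullback (h : C(Z, W)) (pullback (h.symm : C(W, Z)) a) = a := by
  rw [← AddMonoidHom.comp_apply, ← pullback_comp]
  have : (h.symm : C(W, Z)).comp (h : C(Z, W)) = ContinuousMap.id Z := by
    ext z; exact h.symm_apply_apply z
  rw [this, pullback_id, AddMonoidHom.id_apply]

/-- **`K̃` is invariant under homeomorphisms**: if `K̃(W, h z₀) = 0` then `K̃(Z, z₀) = 0`. [folklore] -/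
theorem reduced_eq_bot_of_homeomorph (h : Z ≃ₜ W) (z₀ : Z) (hW : Reduced W (h z₀) = ⊥) : Reduced Z z₀ = ⊥ := by
  rw [eq_bot_iff]
  intro a ha
  have hb : pullback (h.symm : C(W, Z)) a ∈ Reduced W (h z₀) := by
    refine pullback_mem_reduced ?_
    rw [show (h.symm : C(W, Z)) (h z₀) = z₀ from h.symm_apply_apply z₀]
    exact ha
  rw [hW, AddSubgroup.mem_bot] at hb
  rw [AddSubgroup.mem_bot, ← pullback_homeomorph_symm_apply h a, hb, map_zero]

/-- **`K̃((S^p × S^q)/(S^p ∨ S^q)) = 0 ⟹ K̃(S^{p+q}) = 0`** (at the pole). [cite: HatcherVBKT2017, §2.1 Cor. 2.12] -/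
theorem reduced_sphere_eq_bot_of_smash (p q : ℕ)
    (h : Reduced (Collapse (sphere (0 : EuclideanSpace ℝ (Fin (p + 1))) 1 × sphere (0 : EuclideanSpace ℝ (Fin (q + 1))) 1)
        (prodWedgeC (pole p) (pole q))) (Collapse.pt (prodWedgeC (pole p) (pole q))) = ⊥) :
    Reduced (sphere (0 : EuclideanSpace ℝ (Fin (p + q + 1))) 1) (pole (p + q)) = ⊥ := by
  refine reduced_eq_bot_of_homeomorph (sphereSmashHomeomorph p q).symm (pole (p + q)) ?_
  have h2 : (sphereSmashHomeomorph p q).symm (pole (p + q)) = Collapse.pt (prodWedgeC (pole p) (pole q)) := by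
    rw [Homeomorph.symm_apply_eq, sphereSmashHomeomorph_pt]
  rw [h2]
  exact h

/-- **`K̃(S¹) = 0` at every base point** (from `eq_rank_smul_one_S1` of `SphereCaps.lean`).
[cite: HusemollerFibreBundles1994, Ch. 11 Thm. 5.5] -/
theorem reduced_sphere_one_eq_bot (x₀ : sphere (0 : EuclideanSpace ℝ (Fin (1 + 1))) 1) :
    Reduced (sphere (0 : EuclideanSpace ℝ (Fin (1 + 1))) 1) x₀ = ⊥ := by
  rw [eq_bot_iff]
  intro a ha
  rw [AddSubgroup.mem_bot]
  have h := eq_rank_smul_one_S1 a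
  have hr : rankAt x₀ a = rankAt s1Base a := by
    conv_lhs => rw [h]
    rw [map_zsmul, rankAt_one, smul_eq_mul, mul_one]
  rw [mem_reduced_iff, hr] at ha
  rw [h, ha, zero_smul]

end KTheory

end Literature.AlgebraicTopology.KTheory

end
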